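import Summits.QuantumFields.YangMills.Theorems.PoincareLipschitzConeLinkChart
import Mathlib.MeasureTheory.Measure.Haar.InnerProductSpace
import Mathlib.MeasureTheory.Measure.Lebesgue.EqHaar
import HarnessLib

/-!
# Crux `BlockLipschitzL` (stmt-QuantumFields-23533) ∕ `HistoryTailL` (stmt-QuantumFields-19936), LINE 25 «CompactnessTransfer»,
# the (GAP)∕(TM) road (H), brick (T) «CONE → PLANE TRANSPORT» — FILE A2 «THE CHART REGION AND THE ANGULAR INVERSE»

Cell `ym3-torus` (YM ladder rung R3 = continuum SU(2) Yang–Mills on T³ — a RUNG, NOT Clay: not d = 4, not infinite volume,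
not a mass gap); WIDTH helper seat `ym3-torus-px16` g10, typing px14 g7's SPEC `SPEC-ConeLinkChart.px14g7.lean` §2;
`--supports stmt-QuantumFields-23533`; THEOREMS ONLY (0 `def`, 0 `sorry`, default heartbeats); imports FILE A1
✓`…PoincareLipschitzConeLinkChart` (`c`, `σ`: `norm_sigma`, `c_pos`, `differentiable_sigma`) + Mathlib.

THE OBJECTS (def-free, pinned by hypotheses as in A1): `c`, `σ` as there, and
* `π : E³ → E²`, `hπ : ∀ x, π x = (‖x‖ + x 2)⁻¹ • !₂[x 0, x 1]` — the angular inverse on the chart region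
  `V = {x | 0 < ‖x‖ + x 2}` (= `E³` minus the closed ray `{(0,0,−s) | s ≥ 0}`).

WHAT THIS FILE PROVES. `V` is open with Lebesgue-null complement (the ray lies in the line `ℝ ∙ e₂`, a proper subspace:
Mathlib `Measure.addHaar_submodule`), `‖t • σ y‖ = |t|`, `t • σ y ∈ V` (`t > 0`), `π (t • σ y) = y`,
`c (π x) = (‖x‖ + x₂)∕‖x‖` and `‖x‖ • σ (π x) = x` on `V` (the chart is ONTO `V`), `π ∈ C^∞(V)`, and the chain identity
`Dπ_{tσ(y)} (t • Dσ_y v) = v`.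

HONEST SCOPE.  Calculus of one explicit chart; nothing of (T), (Q), (H), (F), (GAP), (TM), S1″, K1, `MeanDeviationL`,
`BlockLipschitzL`, `HistoryTailL` is proved here.  YM₃ on T³ is rung R3, not Clay; YM gap NOT proved; no summit statement is
proved here.

References: R. Schoen, K. Uhlenbeck, Invent. Math. 78 (1984) 89–100 [SchoenUhlenbeck1984] (§1); L. C. Evans, R. F. Gariepy,
Measure Theory and Fine Properties of Functions (1992) [EvansGariepy1992] (§3.3).
-/

set_option autoImplicit false

noncomputable section

open MeasureTheory Set Function Filter Topology Metric
open scoped RealInnerProductSpace BigOperators ContDiff ENNReal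

namespace Summit.QuantumFields.YangMills.Theorems.PoincareLipschitzConeLinkChart

open Literature.Algebra.EuclideanLattices (norm_sq_fin_three)

variable {c : EuclideanSpace ℝ (Fin 2) → ℝ} {σ : EuclideanSpace ℝ (Fin 2) → EuclideanSpace ℝ (Fin 3)}
  {π : EuclideanSpace ℝ (Fin 3) → EuclideanSpace ℝ (Fin 2)}

/-! ## §2 The angular inverse `π` and the chart region `V = {0 < ‖x‖ + x₂}` -/

/-- `V = {0 < ‖x‖ + x₂}` is open. [folklore] -/
theorem isOpen_V : IsOpen {x : EuclideanSpace ℝ (Fin 3) | 0 < ‖x‖ + x 2} :=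
  isOpen_lt continuous_const (continuous_norm.add (contDiff_apply_three 2).continuous)

/-- Points of `V` are nonzero. [folklore] -/
theorem ne_zero_of_mem_V {x : EuclideanSpace ℝ (Fin 3)} (hx : 0 < ‖x‖ + x 2) : x ≠ 0 := by
  rintro rfl
  simp at hx

/-- **The complement of `V` is the closed ray `{x₀ = x₁ = 0, x₂ ≤ 0}`, a Lebesgue-null set** (it lies in the line
`ℝ ∙ e₂`, a proper subspace). [folklore] -/
theorem volume_compl_V : volume {x : EuclideanSpace ℝ (Fin 3) | 0 < ‖x‖ + x 2}ᶜ = 0 := by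
  have hsub : {x : EuclideanSpace ℝ (Fin 3) | 0 < ‖x‖ + x 2}ᶜ ⊆
      ((ℝ ∙ EuclideanSpace.single (2 : Fin 3) (1:ℝ) : Submodule ℝ (EuclideanSpace ℝ (Fin 3))) :
        Set (EuclideanSpace ℝ (Fin 3))) := by
    intro x hx
    simp only [mem_compl_iff, mem_setOf_eq, not_lt] at hx
    have hn := norm_sq_fin_three x
    have hn0 := norm_nonneg x
    have h01 : x 0 ^ 2 + x 1 ^ 2 ≤ 0 := by nlinarith
    have h0 : x 0 = 0 := by nlinarith [sq_nonneg (x 0), sq_nonneg (x 1)]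
    have h1 : x 1 = 0 := by nlinarith [sq_nonneg (x 0), sq_nonneg (x 1)]
    rw [SetLike.mem_coe, Submodule.mem_span_singleton]
    refine ⟨x 2, ?_⟩
    ext i
    fin_cases i <;> simp [h0, h1]
  have hne : (ℝ ∙ EuclideanSpace.single (2 : Fin 3) (1:ℝ) : Submodule ℝ (EuclideanSpace ℝ (Fin 3))) ≠ ⊤ := by
    intro h
    have hm : EuclideanSpace.single (0 : Fin 3) (1:ℝ) ∈
        (ℝ ∙ EuclideanSpace.single (2 : Fin 3) (1:ℝ) : Submodule ℝ (EuclideanSpace ℝ (Fin 3))) := by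
      rw [h]; exact Submodule.mem_top
    rw [Submodule.mem_span_singleton] at hm
    obtain ⟨a, ha⟩ := hm
    have h0 := congrArg (fun v : EuclideanSpace ℝ (Fin 3) => v 0) ha
    simp at h0
  exact measure_mono_null hsub (Measure.addHaar_submodule volume _ hne)

/-- `‖t • σ y‖ = |t|`. [folklore] -/
theorem norm_smul_sigma (hc : ∀ y, c y = 2 / (1 + ‖y‖ ^ 2))
    (hσ : ∀ y, σ y = !₂[c y * y 0, c y * y 1, c y - 1]) (t : ℝ) (y : EuclideanSpace ℝ (Fin 2)) :
    ‖t • σ y‖ = |t| := by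
  rw [norm_smul, norm_sigma hc hσ, mul_one, Real.norm_eq_abs]

/-- `t • σ y ∈ V` for `t > 0` (`‖tσ‖ + (tσ)₂ = t·c(y) > 0`). [folklore] -/
theorem smul_sigma_mem_V (hc : ∀ y, c y = 2 / (1 + ‖y‖ ^ 2))
    (hσ : ∀ y, σ y = !₂[c y * y 0, c y * y 1, c y - 1]) {t : ℝ} (ht : 0 < t) (y : EuclideanSpace ℝ (Fin 2)) :
    0 < ‖t • σ y‖ + (t • σ y) 2 := by
  rw [norm_smul_sigma hc hσ, abs_of_pos ht, hσ, PiLp.smul_apply, (vec3_apply _ _ _).2.2, smul_eq_mul]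
  nlinarith [c_pos hc y]

/-- `π (t • σ y) = y` for `t > 0`: `π` inverts the chart on each sphere. [folklore] -/
theorem pi_smul_sigma (hc : ∀ y, c y = 2 / (1 + ‖y‖ ^ 2))
    (hσ : ∀ y, σ y = !₂[c y * y 0, c y * y 1, c y - 1])
    (hπ : ∀ x, π x = (‖x‖ + x 2)⁻¹ • !₂[x 0, x 1]) {t : ℝ} (ht : 0 < t) (y : EuclideanSpace ℝ (Fin 2)) :
    π (t • σ y) = y := by
  have hc0 : c y ≠ 0 := (c_pos hc y).ne'
  have ht0 : t ≠ 0 := ht.ne'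
  have htc : t + t * (c y - 1) = t * c y := by ring
  have key : ∀ r : ℝ, (t + t * (c y - 1))⁻¹ * (t * (c y * r)) = r := fun r => by
    rw [htc]
    field_simp
  rw [hπ, norm_smul_sigma hc hσ, abs_of_pos ht, hσ]
  ext i
  fin_cases i <;> simp [key]

/-- The conformal factor at `π x`: `c (π x) = (‖x‖ + x₂) ∕ ‖x‖` on `V`. [folklore] -/
theorem c_pi (hc : ∀ y, c y = 2 / (1 + ‖y‖ ^ 2))
    (hπ : ∀ x, π x = (‖x‖ + x 2)⁻¹ • !₂[x 0, x 1]) {x : EuclideanSpace ℝ (Fin 3)} (hx : 0 < ‖x‖ + x 2) :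
    c (π x) = (‖x‖ + x 2) / ‖x‖ := by
  have hn0 : 0 < ‖x‖ := norm_pos_iff.2 (ne_zero_of_mem_V hx)
  have hn := norm_sq_fin_three x
  have hu0 : (‖x‖ + x 2) ≠ 0 := hx.ne'
  have h2 : ‖(!₂[x 0, x 1] : EuclideanSpace ℝ (Fin 2))‖ ^ 2 = x 0 ^ 2 + x 1 ^ 2 := by
    rw [EuclideanSpace.norm_sq_eq, Fin.sum_univ_two, (vec2_apply _ _).1, (vec2_apply _ _).2]
    simp [Real.norm_eq_abs, sq_abs]
  rw [hc, hπ, norm_smul, mul_pow, h2, Real.norm_eq_abs, sq_abs]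
  field_simp
  nlinarith [hn]

/-- `‖x‖ • σ (π x) = x` on `V`: the chart is onto `V`. [folklore] -/
theorem norm_smul_sigma_pi (hc : ∀ y, c y = 2 / (1 + ‖y‖ ^ 2))
    (hσ : ∀ y, σ y = !₂[c y * y 0, c y * y 1, c y - 1])
    (hπ : ∀ x, π x = (‖x‖ + x 2)⁻¹ • !₂[x 0, x 1]) {x : EuclideanSpace ℝ (Fin 3)} (hx : 0 < ‖x‖ + x 2) :
    ‖x‖ • σ (π x) = x := by
  have hn0 : 0 < ‖x‖ := norm_pos_iff.2 (ne_zero_of_mem_V hx)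
  have hu0 : (‖x‖ + x 2) ≠ 0 := hx.ne'
  have hcπ := c_pi hc hπ hx
  have k1 : ∀ r : ℝ, ‖x‖ * ((‖x‖ + x 2) / ‖x‖ * ((‖x‖ + x 2)⁻¹ * r)) = r := fun r => by
    field_simp
  have k2 : ‖x‖ * ((‖x‖ + x 2) / ‖x‖ - 1) = x 2 := by
    field_simp
    ring
  rw [hσ, hcπ, hπ]
  ext i
  fin_cases i <;> simp [k1, k2]

/-- `x ↦ (x₀, x₁) : E³ → E²` is smooth. [folklore] -/
theorem contDiff_vec2_of_three : ContDiff ℝ ∞ (fun x : EuclideanSpace ℝ (Fin 3) => (!₂[x 0, x 1] : EuclideanSpace ℝ (Fin 2))) := by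
  rw [contDiff_euclidean]
  intro i
  fin_cases i
  · exact contDiff_apply_three 0
  · exact contDiff_apply_three 1

/-- `π ∈ C^∞(V)` (the norm is smooth off the origin and `‖x‖ + x₂ ≠ 0` on `V`). [folklore] -/
theorem contDiffOn_pi (hπ : ∀ x, π x = (‖x‖ + x 2)⁻¹ • !₂[x 0, x 1]) :
    ContDiffOn ℝ ∞ π {x : EuclideanSpace ℝ (Fin 3) | 0 < ‖x‖ + x 2} := by
  have h : π = fun x => (‖x‖ + x 2)⁻¹ • !₂[x 0, x 1] := funext hπ
  rw [h]
  intro x hx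
  have hx' : 0 < ‖x‖ + x 2 := hx
  have h1 : ContDiffAt ℝ ∞ (fun x : EuclideanSpace ℝ (Fin 3) => ‖x‖ + x 2) x :=
    (contDiffAt_norm ℝ (ne_zero_of_mem_V hx')).add (contDiff_apply_three 2).contDiffAt
  exact ((h1.inv hx'.ne').smul contDiff_vec2_of_three.contDiffAt).contDiffWithinAt

/-- `π` is differentiable at every point of `V`. [folklore] -/
theorem differentiableAt_pi (hπ : ∀ x, π x = (‖x‖ + x 2)⁻¹ • !₂[x 0, x 1]) {x : EuclideanSpace ℝ (Fin 3)}
    (hx : 0 < ‖x‖ + x 2) : DifferentiableAt ℝ π x :=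
  ((contDiffOn_pi hπ).differentiableOn (by simp) x hx).differentiableAt (isOpen_V.mem_nhds hx)

/-- **CHAIN IDENTITY** `Dπ_{tσ(y)} (t • Dσ_y v) = v` (differentiate `π (t • σ y) = y` in `y`). [folklore] -/
theorem fderiv_pi_smul_fderiv_sigma (hc : ∀ y, c y = 2 / (1 + ‖y‖ ^ 2))
    (hσ : ∀ y, σ y = !₂[c y * y 0, c y * y 1, c y - 1])
    (hπ : ∀ x, π x = (‖x‖ + x 2)⁻¹ • !₂[x 0, x 1]) {t : ℝ} (ht : 0 < t) (y v : EuclideanSpace ℝ (Fin 2)) :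
    fderiv ℝ π (t • σ y) (t • fderiv ℝ σ y v) = v := by
  have hπd : DifferentiableAt ℝ π (t • σ y) := differentiableAt_pi hπ (smul_sigma_mem_V hc hσ ht y)
  have hσd : HasFDerivAt σ (fderiv ℝ σ y) y := (differentiable_sigma hc hσ y).hasFDerivAt
  have hcomp : HasFDerivAt (fun y' => π (t • σ y')) ((fderiv ℝ π (t • σ y)).comp (t • fderiv ℝ σ y)) y :=
    hπd.hasFDerivAt.comp y (hσd.const_smul t)
  have hid : HasFDerivAt (fun y' => π (t • σ y')) (ContinuousLinearMap.id ℝ (EuclideanSpace ℝ (Fin 2))) y := by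
    have h1 : (fun y' => π (t • σ y')) = id := funext fun y' => pi_smul_sigma hc hσ hπ ht y'
    rw [h1]
    exact hasFDerivAt_id y
  have h := congrArg (fun L : EuclideanSpace ℝ (Fin 2) →L[ℝ] EuclideanSpace ℝ (Fin 2) => L v) (hcomp.unique hid)
  simpa using h

end Summit.QuantumFields.YangMills.Theorems.PoincareLipschitzConeLinkChart

end
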